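import Literature.AlgebraicGeometry.Resolution.AlterationsSingularComponentsGlue
import Literature.AlgebraicGeometry.Resolution.FormalNodeRingSingular
import Literature.AlgebraicGeometry.Resolution.GRingPrimeExtension
import Literature.AlgebraicGeometry.Resolution.AlterationsCodimThreeExponents
import Literature.AlgebraicGeometry.Resolution.AlterationsNormalFormCentreFormalIdeal
import Literature.AlgebraicGeometry.Resolution.CompleteFiniteness
import Literature.AlgebraicGeometry.Resolution.AdicQuotient
import Literature.AlgebraicGeometry.Resolution.AlterationsSectionDivisor
import Literature.AlgebraicGeometry.Resolution.AlterationsSemiStableNodeStructure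
import HarnessLib

/-!
# De Jong 1996, 3.5 on complete local rings: `DeJong1996CodimThreeSingularComponentsFormal`
# from the split nodal structure and the G-ring property

Topic: `Literature/AlgebraicGeometry/Resolution`. The named fact
`DeJong1996CodimThreeSingularComponentsFormal` (`AlterationsSingularComponents.lean`; de Jong
1996, 3.5, p. 64: "Each `Eᵢ` maps in a finite étale manner to an irreducible component of some
`Dᵢ ∩ Dⱼ`", read on complete local rings at a closed point `x` of a component `E` of `Sing(X)`:
`(𝒪_{E,x})^ ≅ 𝒪̂_{Y,f x}/(t_a, t_b)` compatibly with `𝒪_{Y,f x} → 𝒪_{X,x} → 𝒪_{E,x}`) is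
PROVED here from the two standard leaves on which the rest of 4.24 already rests:

* `DeJong1996SplitNodalStructure` (`AlterationsFormalNodes.lean`; 2.23 + 3.3, split case:
  `e : 𝒪̂_{X,x} ≅ B = k⟦u, v, T₁, …, T_m⟧/(uv - ∏ Tᵢ^{νᵢ})`, `f^#(tᵢ) ↦ Tᵢ`), and
* `Matsumura1987_32_polynomial` (`ExcellentRings.lean`; polynomial rings over a field are
  G-rings, Matsumura, Cor. of Thm. 32.6) — through "`nᵢ ∈ {0, 1}`"
  (`DeJong1996CodimThreeExponentsLeOne.of_polynomial`) and the G-ring property of `R = 𝒪_{X,x}`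
  (`isGRing_stalk_of_polynomial`): `Reg(Spec R̂)` is the inverse image of `Reg(Spec R)`
  (EGA IV₂ 7.8.3 (v), `IsGRing.isRegularLocalRing_localization_adicCompletion_iff`) and
  `P R̂` is radical for every prime `P` of `R` (`IsGRing.isRadical_map_adicCompletion`).

The argument (3.5: "In the equations above `X` is singular along `u = v = tᵢ = tⱼ = 0`. Let
`Sing(X) = ⋃ Eᵢ` be the decomposition into irreducible components …"), with `P = I_{E,x} ⊂ R`
the prime of the generic point of `E` (a minimal non-regular prime of `R`,
`stalkIdeal_vanishingIdeal_component`) and `𝔔_{ab} = e⁻¹(u, v, T_a, T_b)`: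

1. `core_minimalPrimes`: every minimal prime `𝔔` of `P R̂` is some `𝔔_{ab}` with `a ≠ b`,
   `ν_a = ν_b = 1`: `𝔔 ∩ R = P` (going down), so `R̂_𝔔` is not regular (G-ring), so
   `e(𝔔) ⊇ (u, v, T_a, T_b)` (the Jacobian analysis
   `exists_singPrime_le_of_not_isRegularLocalRing` of `FormalNodeRingSingular.lean`); and
   `𝔔_{ab} ⊆ 𝔔` is a non-regular prime (`B_{(u,v,T_a,T_b)}` is not regular), so `𝔔_{ab} ∩ R ⊆ P`
   is a non-regular prime of `R` (G-ring), equal to `P` by minimality, whence `P R̂ ⊆ 𝔔_{ab}`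
   and `𝔔 = 𝔔_{ab}`.
2. `core_map_eq`: the pair is unique — `f^#(t_a) ∈ 𝔔_{ab} ∩ R = P`, so `T_a ∈ e(𝔔')` for every
   other minimal prime `𝔔' = 𝔔_{cd}`, forcing `a ∈ {c, d}`; hence `P R̂ = 𝔔_{ab}` (`P R̂` is
   radical, `IsGRing.map_adicCompletion_eq_of_forall_minimalPrimes`).
3. `core_bijective`: `(R/P)^ = R̂/P R̂ = R̂/𝔔_{ab} ≅ B/(u, v, T_a, T_b)`, a regular local domain of
   dimension `m - 2` whose maximal ideal is generated by the images of the `tᵢ`; the canonical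
   map `Â = 𝒪̂_{Y,f x} → R̂/P R̂` is onto (Matsumura 8.4: both residue fields are `k`,
   `exists_stalkMap_sub_mem_maximalIdeal`, and `𝔪_Â` generates the maximal ideal) and kills
   `t_a, t_b`; `Â/(t_a, t_b)` being a domain of the same dimension `m - 2`, the induced
   surjection is an isomorphism (`RingHom.injective_of_surjective_of_ringKrullDim_le`).

* `DeJong1996CodimThreeSingularComponentsFormal.of_splitNodal_of_polynomial`, and the
  corollaries `DeJong1996CodimThreeSingularComponentsRegular.of_splitNodal_of_polynomial` (B5)
  and `DeJong1996SemiStablePairIsNormalForm.of_parts_of_splitNodal_of_polynomial`.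

## Sources

* A. J. de Jong, *Smoothness, semi-stability and alterations*, Publ. Math. IHÉS 83 (1996) 51–93:
  2.23 (pp. 61–62), 3.3–3.5 (pp. 63–64), 4.24–4.25 (p. 75). [DeJong1996]
* H. Matsumura, *Commutative Ring Theory* (1986): Thm. 8.4, Thm. 8.11, §32 p. 256 and Cor. of
  Thm. 32.6 (p. 260). [Matsumura1987]
* A. Grothendieck, EGA IV₂, Scholie 7.8.3 (v), (vii).
-/

noncomputable section

open CategoryTheory CategoryTheory.Limits AlgebraicGeometry TopologicalSpace Topology

namespace Literature.AlgebraicGeometry.Resolution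

universe u

open IsLocalRing Scheme.IdealSheafData

/-! ## More on `(u, v, T_a, T_b) ⊂ B` -/

namespace DeJong1996.FormalNodeRing

variable (k : Type u) [Field k] {m : ℕ} {ν : Fin m → ℕ}

/-- **`T_c ∈ (u, v, T_a, T_b)B` iff `c ∈ {a, b}`** (`a ≠ b`, `ν_a, ν_b ≥ 1`): a member of a
regular system of parameters of `k⟦u, v, T⟧` does not lie in the ideal generated by other
members. [cite: Matsumura1987, Thm. 14.2] -/
theorem mk_X_inr_mem_singPrime_iff {a b : Fin m} (hab : a ≠ b) (ha : ν a ≠ 0) (hb : ν b ≠ 0)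
    (c : Fin m) :
    Ideal.Quotient.mk (Ideal.span {formalNodeRelation k m ν}) (MvPowerSeries.X (Sum.inr c)) ∈
        singPrime k m ν a b ↔ c = a ∨ c = b := by
  constructor
  · intro hc
    by_contra hne
    push Not at hne
    have hc' : (MvPowerSeries.X (Sum.inr c) : MvPowerSeries (Fin 2 ⊕ Fin m) k) ∈
        Ideal.span (Set.range fun j =>
          (MvPowerSeries.X (quadVars a b j) : MvPowerSeries (Fin 2 ⊕ Fin m) k)) := by
      rw [← comap_varIdeal k (quadVars a b) (formalNodeRelation_mem_quad k hab ha hb),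
        Ideal.mem_comap]
      exact hc
    -- the five distinct variables `u, v, T_a, T_b, T_c`
    let w : Fin 5 → Fin 2 ⊕ Fin m := ![Sum.inl 0, Sum.inl 1, Sum.inr a, Sum.inr b, Sum.inr c]
    have hw : Function.Injective w := by
      intro i j h
      fin_cases i <;> fin_cases j <;> simp_all [w, hne.1, hne.2, Ne.symm hne.1, Ne.symm hne.2]
    have hz := MvPowerSeries.isRsopPart_X_of_injective k w hw
    have h4 : (4 : Fin 5) ∉ ({0, 1, 2, 3} : Set (Fin 5)) := by decide
    have hnot := hz.not_mem_span_image (S := ({0, 1, 2, 3} : Set (Fin 5))) (i := 4) h4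
    apply hnot
    have hset : (fun j => (MvPowerSeries.X (w j) : MvPowerSeries (Fin 2 ⊕ Fin m) k)) ''
        ({0, 1, 2, 3} : Set (Fin 5)) =
        Set.range fun j => (MvPowerSeries.X (quadVars a b j) : MvPowerSeries (Fin 2 ⊕ Fin m) k) := by
      rw [range_X_quadVars]
      ext φ
      simp only [Set.mem_image, Set.mem_insert_iff, Set.mem_singleton_iff]
      constructor
      · rintro ⟨j, hj, rfl⟩
        rcases hj with rfl | rfl | rfl | rfl <;> simp [w]
      · rintro (rfl | rfl | rfl | rfl)
        · exact ⟨0, Or.inl rfl, rfl⟩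
        · exact ⟨1, Or.inr (Or.inl rfl), rfl⟩
        · exact ⟨2, Or.inr (Or.inr (Or.inl rfl)), rfl⟩
        · exact ⟨3, Or.inr (Or.inr (Or.inr rfl)), rfl⟩
    rw [hset]
    exact hc'
  · rintro (rfl | rfl)
    · exact (mk_X_mem_singPrime k (ν := ν) c b).2.2.1
    · exact (mk_X_mem_singPrime k (ν := ν) a c).2.2.2

/-- `(u, v, T_a, T_b) = (u, v, T_b, T_a)`. [folklore] -/
theorem singPrime_comm (a b : Fin m) : singPrime k m ν a b = singPrime k m ν b a := by
  change varIdeal k m ν (quadVars a b) = varIdeal k m ν (quadVars b a)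
  unfold varIdeal
  rw [range_X_quadVars, range_X_quadVars]
  congr 2
  ext φ
  simp only [Set.mem_insert_iff, Set.mem_singleton_iff]
  tauto

end DeJong1996.FormalNodeRing

/-! ## The core: a prime `P` of `R` with `R̂ ≅ B` -/

section Core

open DeJong1996 DeJong1996.FormalNodeRing

variable {k : Type u} [Field k] {m : ℕ} {ν : Fin m → ℕ} {R : Type u} [CommRing R]
  [IsLocalRing R]

/-- **Step 1: the minimal primes of `P R̂` are among the `e⁻¹(u, v, T_a, T_b)`.** Let `R` be a
Noetherian local G-ring with an isomorphism `e : R̂ ≅ B = k⟦u, v, T⟧/(uv - ∏ Tᵢ^{νᵢ})`, all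
`νᵢ ≤ 1`, and `P` a prime of `R` with `R_P` not regular and minimal with this property below
itself. Then every minimal prime `𝔔` of `P R̂` is `e⁻¹(u, v, T_a, T_b)` for some `a ≠ b` with
`ν_a = ν_b = 1` (see the module docstring, 1). [cite: DeJong1996, 3.5, p. 64] -/
theorem core_minimalPrimes (hG : IsGRing R) (hν1 : ∀ i, ν i ≤ 1)
    (e : AdicCompletion (maximalIdeal R) R ≃+* FormalNodeRing k m ν) (P : Ideal R) [P.IsPrime]
    (hPreg : ¬ IsRegularLocalRing (Localization.AtPrime P))
    (hPmin : ∀ (q : Ideal R) (hq : q.IsPrime), q ≤ P →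
      ¬ IsRegularLocalRing (@Localization.AtPrime _ _ q hq) → q = P)
    {Q : Ideal (AdicCompletion (maximalIdeal R) R)}
    (hQ : Q ∈ (P.map (algebraMap R (AdicCompletion (maximalIdeal R) R))).minimalPrimes) :
    ∃ a b : Fin m, a ≠ b ∧ ν a = 1 ∧ ν b = 1 ∧ Q = (singPrime k m ν a b).comap e.toRingHom := by
  haveI : IsNoetherianRing R := hG.1
  set Rh := AdicCompletion (maximalIdeal R) R with hRh
  haveI : IsNoetherianRing Rh := isNoetherianRing_adicCompletion_maximalIdeal R
  haveI : Module.Flat R Rh := AdicCompletion.flat_of_isNoetherian _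
  haveI : Algebra.HasGoingDown R Rh := Algebra.HasGoingDown.of_flat
  haveI hQp : Q.IsPrime := hQ.1.1
  set J : Ideal Rh := P.map (algebraMap R Rh) with hJ
  -- `𝔔 ∩ R = P`, so `R̂_𝔔` is not regular
  have hunder : Q.under R = P := Ideal.under_eq_of_mem_minimalPrimes_map P hQ
  have hQreg : ¬ IsRegularLocalRing (Localization.AtPrime Q) := fun h =>
    hPreg ((isRegularLocalRing_localization_congr hunder).mp
      ((hG.isRegularLocalRing_localization_adicCompletion_iff Q).1.mp h))
  -- transported to `B`: `e(𝔔) ⊇ (u, v, T_a, T_b)`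
  haveI : (Q.map e.toRingHom).IsPrime := Ideal.map_isPrime_of_equiv e
  have hQ'reg : ¬ IsRegularLocalRing (Localization.AtPrime (Q.map e.toRingHom)) := fun h =>
    hQreg ((isRegularLocalRing_localization_map_ringEquiv_iff e Q).mp h)
  obtain ⟨a, b, hab, ha, hb, hle⟩ :=
    exists_singPrime_le_of_not_isRegularLocalRing k hν1 (Q.map e.toRingHom) hQ'reg
  refine ⟨a, b, hab, ha, hb, ?_⟩
  have ha0 : ν a ≠ 0 := by rw [ha]; exact one_ne_zero
  have hb0 : ν b ≠ 0 := by rw [hb]; exact one_ne_zero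
  -- `𝔔_{ab} = e⁻¹(u, v, T_a, T_b) ⊆ 𝔔` is a non-regular prime
  haveI hSp : (singPrime k m ν a b).IsPrime := isPrime_singPrime k hab ha0 hb0
  set Q₀ : Ideal Rh := (singPrime k m ν a b).comap e.toRingHom with hQ₀
  haveI hQ₀p : Q₀.IsPrime := Ideal.comap_isPrime _ _
  have hQ₀Q : Q₀ ≤ Q := by
    have h1 := Ideal.comap_mono (f := e.toRingHom) hle
    rwa [Ideal.comap_map_of_bijective e.toRingHom e.bijective] at h1
  have hQ₀reg : ¬ IsRegularLocalRing (Localization.AtPrime Q₀) := fun h =>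
    not_isRegularLocalRing_localization_singPrime k hab ha0 hb0
      ((isRegularLocalRing_localization_comap_ringEquiv_iff e (singPrime k m ν a b)).mp h)
  -- so `𝔔₀ ∩ R ⊆ P` is non-regular, hence `= P`, hence `P R̂ ⊆ 𝔔₀` and `𝔔 = 𝔔₀`
  have hQ₀under : ¬ IsRegularLocalRing (Localization.AtPrime (Q₀.under R)) := fun h =>
    hQ₀reg ((hG.isRegularLocalRing_localization_adicCompletion_iff Q₀).1.mpr h)
  have hle' : Q₀.under R ≤ P := hunder ▸ Ideal.comap_mono hQ₀Q
  have heq : Q₀.under R = P := hPmin _ inferInstance hle' hQ₀under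
  have hJQ₀ : J ≤ Q₀ := by
    rw [hJ, Ideal.map_le_iff_le_comap]
    exact heq.ge
  exact le_antisymm (hQ.2 ⟨hQ₀p, hJQ₀⟩ hQ₀Q) hQ₀Q

/-- **Step 2: `P R̂ = e⁻¹(u, v, T_a, T_b)` for a unique pair, and `τ_a, τ_b ∈ P`.** In the
situation of `core_minimalPrimes`, given elements `τᵢ ∈ R` with `e(τᵢ) = Tᵢ`: there are `a ≠ b`
with `ν_a = ν_b = 1`, `τ_a, τ_b ∈ P` and `P R̂ = e⁻¹(u, v, T_a, T_b)` (`P R̂` is radical as `R` is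
a G-ring, and its minimal primes coincide: `τ_a ∈ P` lies in every one of them).
[cite: DeJong1996, 3.5, p. 64] -/
theorem core_map_eq (hG : IsGRing R) (hν1 : ∀ i, ν i ≤ 1)
    (e : AdicCompletion (maximalIdeal R) R ≃+* FormalNodeRing k m ν) (τ : Fin m → R)
    (hτ : ∀ i, e (algebraMap R _ (τ i)) = Ideal.Quotient.mk _ (MvPowerSeries.X (Sum.inr i)))
    (P : Ideal R) [P.IsPrime] (hPreg : ¬ IsRegularLocalRing (Localization.AtPrime P))
    (hPmin : ∀ (q : Ideal R) (hq : q.IsPrime), q ≤ P →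
      ¬ IsRegularLocalRing (@Localization.AtPrime _ _ q hq) → q = P) :
    ∃ a b : Fin m, a ≠ b ∧ ν a = 1 ∧ ν b = 1 ∧ τ a ∈ P ∧ τ b ∈ P ∧
      P.map (algebraMap R (AdicCompletion (maximalIdeal R) R)) =
        (singPrime k m ν a b).comap e.toRingHom := by
  haveI : IsNoetherianRing R := hG.1
  set Rh := AdicCompletion (maximalIdeal R) R with hRh
  haveI : IsNoetherianRing Rh := isNoetherianRing_adicCompletion_maximalIdeal R
  haveI : Module.Flat R Rh := AdicCompletion.flat_of_isNoetherian _
  haveI : Algebra.HasGoingDown R Rh := Algebra.HasGoingDown.of_flat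
  set J : Ideal Rh := P.map (algebraMap R Rh) with hJ
  -- a minimal prime of `J` (`J ⊆ 𝔪 R̂ ≠ ⊤`)
  have hJle : J ≤ maximalIdeal Rh := by
    rw [hJ, AdicCompletion.maximalIdeal_eq_map]
    exact Ideal.map_mono (IsLocalRing.le_maximalIdeal (Ideal.IsPrime.ne_top ‹_›))
  obtain ⟨Q, hQ, -⟩ := Ideal.exists_minimalPrimes_le hJle
  obtain ⟨a, b, hab, ha, hb, hQeq⟩ := core_minimalPrimes hG hν1 e P hPreg hPmin hQ
  have ha0 : ν a ≠ 0 := by rw [ha]; exact one_ne_zero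
  have hb0 : ν b ≠ 0 := by rw [hb]; exact one_ne_zero
  -- `τ_c ∈ P` for `c ∈ {a, b}`: `e(τ_c) = T_c ∈ (u, v, T_a, T_b)` and `𝔔 ∩ R = P`
  have hunder : Q.under R = P := Ideal.under_eq_of_mem_minimalPrimes_map P hQ
  have hmemP : ∀ c, c = a ∨ c = b → τ c ∈ P := by
    intro c hc
    rw [← hunder, Ideal.mem_comap, hQeq, Ideal.mem_comap, RingEquiv.toRingHom_eq_coe,
      RingHom.coe_coe, hτ c]
    exact (mk_X_inr_mem_singPrime_iff k hab ha0 hb0 c).mpr hc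
  refine ⟨a, b, hab, ha, hb, hmemP a (Or.inl rfl), hmemP b (Or.inr rfl), ?_⟩
  -- every minimal prime of `J` is `𝔔`
  rw [← hQeq]
  refine hG.map_adicCompletion_eq_of_forall_minimalPrimes P hQ fun Q' hQ' => ?_
  obtain ⟨c, d, hcd, hc, hd, hQ'eq⟩ := core_minimalPrimes hG hν1 e P hPreg hPmin hQ'
  have hc0 : ν c ≠ 0 := by rw [hc]; exact one_ne_zero
  have hd0 : ν d ≠ 0 := by rw [hd]; exact one_ne_zero
  -- `T_a, T_b ∈ (u, v, T_c, T_d)`, so `{a, b} = {c, d}`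
  have hin : ∀ x, x = a ∨ x = b → x = c ∨ x = d := by
    intro x hx
    have h1 : algebraMap R Rh (τ x) ∈ Q' := hQ'.1.2 (Ideal.mem_map_of_mem _ (hmemP x hx))
    rw [hQ'eq, Ideal.mem_comap, RingEquiv.toRingHom_eq_coe, RingHom.coe_coe, hτ x] at h1
    exact (mk_X_inr_mem_singPrime_iff k hcd hc0 hd0 x).mp h1
  rw [hQ'eq, hQeq]
  rcases hin a (Or.inl rfl) with rfl | rfl
  · rcases hin b (Or.inr rfl) with h | rfl
    · exact absurd h hab.symm
    · rfl
  · rcases hin b (Or.inr rfl) with rfl | h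
    · rw [singPrime_comm]
    · exact absurd h hab.symm

/-- A finite non-negative dimension cast: from `d + 2 = m` and `d' + 4 = m + 2` in `WithBot ℕ∞`
(with `d, d'` dimensions of Noetherian local rings) conclude `d = d'`. [folklore] -/
theorem ringKrullDim_eq_of_add_eq {S S' : Type u} [CommRing S] [CommRing S'] [IsLocalRing S]
    [IsLocalRing S'] [IsNoetherianRing S] [IsNoetherianRing S'] {m : ℕ}
    (h : ringKrullDim S + 2 = (m : WithBot ℕ∞)) (h' : ringKrullDim S' + 4 = (m + 2 : ℕ)) :
    ringKrullDim S = ringKrullDim S' := by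
  obtain ⟨d, hd⟩ := exists_nat_cast_eq_ringKrullDim (R := S)
  obtain ⟨d', hd'⟩ := exists_nat_cast_eq_ringKrullDim (R := S')
  rw [hd] at h ⊢
  rw [hd'] at h' ⊢
  have h1 : d + 2 = m := by exact_mod_cast h
  have h2 : d' + 4 = m + 2 := by exact_mod_cast h'
  have : d = d' := by omega
  rw [this]

variable {A : Type u} [CommRing A]

/-- **Step 3: the canonical map `Â/(t_a, t_b) → R̂/P R̂` is an isomorphism.** Let moreover
`φ : A → R` be a local homomorphism from a regular local ring `A` of dimension `m` whose maximal
ideal is generated by `t₁, …, t_m`, with `e(φ(tᵢ)) = Tᵢ` and `A → R/𝔪_R` onto. If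
`P R̂ = e⁻¹(u, v, T_a, T_b)` with `φ(t_a), φ(t_b) ∈ P`, then the map `Â → R̂ → R̂/P R̂` induces
an isomorphism `Â/(t_a, t_b)Â ≅ R̂/P R̂`: it is onto by Matsumura's Thm. 8.4 (the residue
fields agree and `𝔪_Â` generates the maximal ideal of `R̂/P R̂ ≅ B/(u, v, T_a, T_b)`, which is
generated by the classes of the `Tᵢ`), it kills `t_a, t_b`, and `Â/(t_a, t_b)` is a local
domain of the same dimension `m - 2` as the domain `R̂/P R̂`. [cite: DeJong1996, 3.5, p. 64] -/
theorem core_bijective [IsRegularLocalRing A] [IsNoetherianRing R]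
    (e : AdicCompletion (maximalIdeal R) R ≃+* FormalNodeRing k m ν) (φ : A →+* R)
    [IsLocalHom φ] (t : Fin m → A) (hspan : Ideal.span (Set.range t) = maximalIdeal A)
    (hdim : ringKrullDim A = m)
    (hτ : ∀ i, e (algebraMap R _ (φ (t i))) = Ideal.Quotient.mk _ (MvPowerSeries.X (Sum.inr i)))
    (hres : ∀ r : R, ∃ a : A, φ a - r ∈ maximalIdeal R)
    (P : Ideal R) [P.IsPrime] {a b : Fin m} (hab : a ≠ b) (ha : ν a ≠ 0) (hb : ν b ≠ 0)
    (hta : φ (t a) ∈ P) (htb : φ (t b) ∈ P)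
    (hPJ : P.map (algebraMap R (AdicCompletion (maximalIdeal R) R)) =
      (singPrime k m ν a b).comap e.toRingHom) :
    ∃ θ : AdicCompletion (maximalIdeal A) A →+*
        AdicCompletion (maximalIdeal R) R ⧸
          P.map (algebraMap R (AdicCompletion (maximalIdeal R) R)),
      (∀ c : A, θ (algebraMap A _ c) = Ideal.Quotient.mk _ (algebraMap R _ (φ c))) ∧
      Function.Surjective θ ∧
      RingHom.ker θ = Ideal.span {algebraMap A _ (t a), algebraMap A _ (t b)} := by
  classical
  set Rh := AdicCompletion (maximalIdeal R) R with hRh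
  set Ah := AdicCompletion (maximalIdeal A) A with hAh
  haveI : IsNoetherianRing Rh := isNoetherianRing_adicCompletion_maximalIdeal R
  haveI : IsNoetherianRing Ah := isNoetherianRing_adicCompletion_maximalIdeal A
  set J : Ideal Rh := P.map (algebraMap R Rh) with hJ
  set C := Rh ⧸ J with hC
  -- `C ≅ B/(u, v, T_a, T_b)`: a regular local domain of dimension `m - 2`
  haveI hSp : (singPrime k m ν a b).IsPrime := isPrime_singPrime k hab ha hb
  have hJmap : J.map e.toRingHom = singPrime k m ν a b := by
    rw [hPJ]
    exact Ideal.map_comap_of_surjective e.toRingHom e.surjective _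
  let eC : C ≃+* FormalNodeRing k m ν ⧸ singPrime k m ν a b :=
    Ideal.quotientEquiv J (singPrime k m ν a b) e hJmap.symm
  obtain ⟨hBreg, hBdim⟩ := isRegularLocalRing_quotient_singPrime k hab ha hb
  haveI : IsLocalRing (FormalNodeRing k m ν ⧸ singPrime k m ν a b) := hBreg.toIsLocalRing
  haveI : IsRegularLocalRing C :=
    IsRegularLocalRing.of_ringEquiv (R := FormalNodeRing k m ν ⧸ singPrime k m ν a b) eC.symm
  haveI : IsDomain C := isDomain_of_isRegularLocalRing C
  haveI : IsLocalHom (Ideal.Quotient.mk J) := IsLocalHom.of_surjective _ Ideal.Quotient.mk_surjective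
  have hCdim : ringKrullDim C + 4 = (m + 2 : ℕ) := by
    rw [ringKrullDim_eq_of_ringEquiv (R := C) (S := FormalNodeRing k m ν ⧸ singPrime k m ν a b) eC]
    exact hBdim
  -- the map `θ : Â → R̂ → C`
  have hφle : (maximalIdeal A).map φ ≤ maximalIdeal R :=
    ((IsLocalRing.local_hom_TFAE φ).out 0 2).mp ‹IsLocalHom φ›
  let ψ : Ah →+* Rh := adicCompletionMap (maximalIdeal A) (maximalIdeal R) φ hφle
  have hψ : ∀ c : A, ψ (algebraMap A Ah c) = algebraMap R Rh (φ c) := fun c =>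
    adicCompletionMap_of (maximalIdeal A) (maximalIdeal R) φ hφle c
  let θ : Ah →+* C := (Ideal.Quotient.mk J).comp ψ
  have hθ : ∀ c : A, θ (algebraMap A Ah c) = Ideal.Quotient.mk J (algebraMap R Rh (φ c)) := by
    intro c
    change Ideal.Quotient.mk J (ψ (algebraMap A Ah c)) = _
    rw [hψ]
  -- the images of the `tᵢ` generate the maximal ideal of `C`
  have hmaxC : maximalIdeal C ≤ Ideal.span (Set.range fun i => θ (algebraMap A Ah (t i))) := by
    -- through `eC`: `𝔪_{B/𝔭} ≤ (T̄ᵢ)` (`map_maximalIdeal_quotient_singPrime_le`)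
    have hν : ∃ i, ν i ≠ 0 := ⟨a, ha⟩
    haveI := FormalNodeRing.isLocalRing k m hν
    have h1 : maximalIdeal (FormalNodeRing k m ν ⧸ singPrime k m ν a b) ≤
        Ideal.span (Set.range fun j : Fin m => Ideal.Quotient.mk (singPrime k m ν a b)
          (Ideal.Quotient.mk (Ideal.span {formalNodeRelation k m ν})
            (MvPowerSeries.X (Sum.inr j)))) := by
      rw [maximalIdeal_quotient_eq_map]
      exact map_maximalIdeal_quotient_singPrime_le k ha
    intro c hc
    have hc' : eC c ∈ maximalIdeal _ := by
      rw [IsLocalRing.mem_maximalIdeal] at hc ⊢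
      exact (map_mem_nonunits_iff eC c).mpr hc
    have h2 := h1 hc'
    have h3 : c = eC.symm (eC c) := (eC.symm_apply_apply c).symm
    rw [h3]
    have hrange : (Set.range fun i => θ (algebraMap A Ah (t i))) =
        eC.symm '' (Set.range fun j : Fin m => Ideal.Quotient.mk (singPrime k m ν a b)
          (Ideal.Quotient.mk (Ideal.span {formalNodeRelation k m ν})
            (MvPowerSeries.X (Sum.inr j)))) := by
      rw [← Set.range_comp]
      congr 1
      funext i
      simp only [Function.comp_apply]
      apply eC.injective
      rw [RingEquiv.apply_symm_apply, hθ, ← hτ i]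
      rfl
    have h4 := Ideal.mem_map_of_mem eC.symm.toRingHom h2
    rw [Ideal.map_span] at h4
    rw [hrange]
    exact h4
  -- `θ` is onto (Matsumura 8.4 over the complete ring `Â`)
  have hsurj : Function.Surjective θ := by
    letI : Algebra Ah C := θ.toAlgebra
    have hI : (maximalIdeal A).FG := IsNoetherian.noetherian _
    set I : Ideal Ah := (maximalIdeal A).map (algebraMap A Ah) with hI'
    haveI : IsAdicComplete I Ah := AdicCompletion.isAdicComplete_self (maximalIdeal A) hI
    -- `I C ≤ 𝔪_C`, `C` is `𝔪_C`-adically separated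
    have hIC : I.map θ ≤ maximalIdeal C := by
      rw [hI', Ideal.map_map, Ideal.map_le_iff_le_comap]
      intro x hx
      rw [Ideal.mem_comap, RingHom.comp_apply, hθ]
      have h1 : φ x ∈ maximalIdeal R := hφle (Ideal.mem_map_of_mem φ hx)
      have h2 : algebraMap R Rh (φ x) ∈ maximalIdeal Rh := by
        rw [AdicCompletion.maximalIdeal_eq_map]; exact Ideal.mem_map_of_mem _ h1
      exact map_nonunit (Ideal.Quotient.mk J) _ h2
    haveI : IsHausdorff I C := by
      refine ⟨fun x hx => ?_⟩
      have hmem : ∀ n : ℕ, x ∈ maximalIdeal C ^ n := by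
        intro n
        have h1 := hx n
        rw [SModEq.zero, Ideal.smul_top_eq_map, Submodule.restrictScalars_mem, Ideal.map_pow,
          RingHom.algebraMap_toAlgebra] at h1
        exact Ideal.pow_right_mono hIC n h1
      have h2 : x ∈ (⨅ n : ℕ, maximalIdeal C ^ n) := Ideal.mem_iInf.mpr hmem
      rwa [Ideal.iInf_pow_eq_bot_of_isLocalRing _ (maximalIdeal.isMaximal C).ne_top,
        Ideal.mem_bot] at h2
    -- `C = θ(Â) + I C`
    have hsup : Submodule.span Ah (Set.range fun _ : Fin 1 => (1 : C)) ⊔ (I • ⊤ : Submodule Ah C) =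
        ⊤ := by
      refine Submodule.eq_top_iff'.mpr fun c => ?_
      obtain ⟨z, rfl⟩ := Ideal.Quotient.mk_surjective c
      -- `z ≡ r (mod 𝔪 R̂)` for some `r ∈ R`, and `r ≡ φ a₀ (mod 𝔪_R)`
      obtain ⟨r, hr⟩ : ∃ r : R, z - algebraMap R Rh r ∈ maximalIdeal Rh := by
        obtain ⟨r, hr⟩ := Ideal.Quotient.mk_surjective (AdicCompletion.evalOneₐ (maximalIdeal R) z)
        refine ⟨r, ?_⟩
        rw [AdicCompletion.maximalIdeal_eq_map,
          ← AdicCompletion.ker_evalOneₐ_eq_map _ (IsNoetherian.noetherian _), RingHom.mem_ker]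
        change AdicCompletion.evalOneₐ (maximalIdeal R) (z - algebraMap R Rh r) = 0
        rw [map_sub, ← hr, AdicCompletion.algebraMap_apply, Algebra.algebraMap_self,
          RingHom.id_apply, AdicCompletion.evalOneₐ_of, sub_self]
      obtain ⟨a₀, ha₀⟩ := hres r
      have hz : Ideal.Quotient.mk J z - θ (algebraMap A Ah a₀) ∈ maximalIdeal C := by
        rw [hθ, ← map_sub]
        refine map_nonunit (Ideal.Quotient.mk J) _ ?_
        have : z - algebraMap R Rh (φ a₀) =
            (z - algebraMap R Rh r) - algebraMap R Rh (φ a₀ - r) := by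
          rw [map_sub]; ring
        rw [this]
        refine Ideal.sub_mem _ hr ?_
        rw [AdicCompletion.maximalIdeal_eq_map]
        exact Ideal.mem_map_of_mem _ ha₀
      -- `𝔪_C ⊆ (θ(tᵢ)) ⊆ I C = I • ⊤`
      have hmC : maximalIdeal C ≤ I.map θ := by
        refine hmaxC.trans ?_
        rw [Ideal.span_le, Set.range_subset_iff]
        intro i
        exact Ideal.mem_map_of_mem θ (Ideal.mem_map_of_mem _ (hspan ▸ Ideal.subset_span ⟨i, rfl⟩ :
          t i ∈ maximalIdeal A))
      have hin : Ideal.Quotient.mk J z - θ (algebraMap A Ah a₀) ∈ (I • ⊤ : Submodule Ah C) := by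
        rw [Ideal.smul_top_eq_map, Submodule.restrictScalars_mem, RingHom.algebraMap_toAlgebra]
        exact hmC hz
      have hone : θ (algebraMap A Ah a₀) ∈ Submodule.span Ah (Set.range fun _ : Fin 1 => (1 : C)) := by
        have : θ (algebraMap A Ah a₀) = (algebraMap A Ah a₀) • (1 : C) := by
          rw [Algebra.smul_def, RingHom.algebraMap_toAlgebra, mul_one]
        rw [this]
        exact Submodule.smul_mem _ _ (Submodule.subset_span ⟨0, rfl⟩)
      have : Ideal.Quotient.mk J z =
          θ (algebraMap A Ah a₀) + (Ideal.Quotient.mk J z - θ (algebraMap A Ah a₀)) := by ring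
      rw [this]
      exact Submodule.add_mem_sup hone hin
    have htop := Matsumura1987_8_4 I (fun _ : Fin 1 => (1 : C)) hsup
    intro c
    have hc : c ∈ Submodule.span Ah (Set.range fun _ : Fin 1 => (1 : C)) := htop ▸ Submodule.mem_top
    rw [show Set.range (fun _ : Fin 1 => (1 : C)) = {1} from by
      ext; simp, Submodule.mem_span_singleton] at hc
    obtain ⟨y, rfl⟩ := hc
    exact ⟨y, by rw [Algebra.smul_def, RingHom.algebraMap_toAlgebra, mul_one]⟩
  -- the kernel contains `t_a, t_b`
  set K : Ideal Ah := Ideal.span {algebraMap A Ah (t a), algebraMap A Ah (t b)} with hK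
  have hKle : K ≤ RingHom.ker θ := by
    rw [hK, Ideal.span_le]
    intro y hy
    rcases hy with rfl | rfl
    · rw [SetLike.mem_coe, RingHom.mem_ker, hθ, Ideal.Quotient.eq_zero_iff_mem]
      exact Ideal.mem_map_of_mem _ hta
    · rw [SetLike.mem_coe, RingHom.mem_ker, hθ, Ideal.Quotient.eq_zero_iff_mem]
      exact Ideal.mem_map_of_mem _ htb
  -- `Â/(t_a, t_b)` is a regular local ring (domain) of dimension `m - 2`
  haveI hKreg : IsRegularLocalRing (Ah ⧸ K) := by
    have h := isRegularLocalRing_adicCompletion_quotient_span_pair (A := A) (r := m) (e := 0) t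
      Fin.elim0 (by rw [hdim]; rfl)
      (by rw [Set.range_eq_empty Fin.elim0, Set.union_empty, hspan]) a b
    exact h
  haveI : IsDomain (Ah ⧸ K) := isDomain_of_isRegularLocalRing _
  have hKdim : ringKrullDim (Ah ⧸ K) + 2 = (m : WithBot ℕ∞) := by
    -- `t_a, t_b` is part of the regular system of parameters `t` of `Â`
    haveI : IsRegularLocalRing Ah := isRegularLocalRing_adicCompletion A
    have hz : IsRsopPart (fun i => algebraMap A Ah (t i)) := by
      refine ⟨inferInstance, 0, Fin.elim0, ?_, ?_⟩
      · show ringKrullDim (AdicCompletion (maximalIdeal A) A) = _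
        rw [ringKrullDim_adicCompletion, hdim]
        rfl
      · rw [Set.range_eq_empty Fin.elim0, Set.union_empty]
        show Ideal.span (Set.range fun i => algebraMap A (AdicCompletion (maximalIdeal A) A) (t i)) =
          maximalIdeal (AdicCompletion (maximalIdeal A) A)
        rw [AdicCompletion.maximalIdeal_eq_map, ← hspan, Ideal.map_span, ← Set.range_comp]
        rfl
    have hinj : Function.Injective (![a, b] : Fin 2 → Fin m) := by
      intro i j h
      fin_cases i <;> fin_cases j
      · rfl
      · simp at h
        exact absurd h hab
      · simp at h
        exact absurd h.symm hab
      · rfl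
    have h2 := (hz.comp ![a, b] hinj).ringKrullDim_quotient_add
    have hrange : Set.range ((fun i => algebraMap A Ah (t i)) ∘ ![a, b]) =
        {algebraMap A Ah (t a), algebraMap A Ah (t b)} := by
      ext y
      simp only [Set.mem_range, Function.comp_apply, Set.mem_insert_iff, Set.mem_singleton_iff]
      constructor
      · rintro ⟨i, rfl⟩
        fin_cases i <;> simp
      · rintro (rfl | rfl)
        · exact ⟨0, by simp⟩
        · exact ⟨1, by simp⟩
    rw [hrange] at h2
    change ringKrullDim (Ah ⧸ Ideal.span {algebraMap A Ah (t a), algebraMap A Ah (t b)}) +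
      ((2 : ℕ) : WithBot ℕ∞) = ringKrullDim Ah at h2
    rw [Nat.cast_ofNat] at h2
    rw [hK, h2]
    show ringKrullDim (AdicCompletion (maximalIdeal A) A) = _
    rw [ringKrullDim_adicCompletion, hdim]
  -- the induced surjection `Â/(t_a, t_b) → C` is injective by dimension count
  let θ' : Ah ⧸ K →+* C := Ideal.Quotient.lift K θ fun y hy => hKle hy
  have hθ'surj : Function.Surjective θ' := by
    intro c
    obtain ⟨y, rfl⟩ := hsurj c
    exact ⟨Ideal.Quotient.mk K y, rfl⟩
  have hθ'inj : Function.Injective θ' :=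
    RingHom.injective_of_surjective_of_ringKrullDim_le θ' hθ'surj
      (le_of_eq (ringKrullDim_eq_of_add_eq hKdim hCdim))
  refine ⟨θ, hθ, hsurj, le_antisymm (fun y hy => ?_) hKle⟩
  rw [← Ideal.Quotient.eq_zero_iff_mem]
  apply hθ'inj
  rw [map_zero]
  exact hy

end Core

/-! ## The assembly -/

/-- **de Jong 1996, 3.5 on complete local rings, from the split nodal structure and the G-ring
property of polynomial rings over a field**:
`DeJong1996SplitNodalStructure → Matsumura1987_32_polynomial →
DeJong1996CodimThreeSingularComponentsFormal`. See the module docstring for the proof.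
[cite: DeJong1996, 3.5, p. 64] -/
theorem DeJong1996CodimThreeSingularComponentsFormal.of_splitNodal_of_polynomial
    (hN : DeJong1996SplitNodalStructure.{u}) (hp : Matsumura1987_32_polynomial.{u}) :
    DeJong1996CodimThreeSingularComponentsFormal.{u} := by
  intro k _ _ X Y f g D n τ hS hcodim E hE x hxE hx
  classical
  haveI := hS.isIntegral
  haveI := hS.locallyOfFiniteType
  haveI := hS.isNoetherian
  haveI := hS.isSemiStableCurve.isProper
  haveI : IsProper g :=
    Literature.AlgebraicGeometry.Motives.IsProjectiveOver.isProper (X := Over.mk g)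
      hS.isProjectiveOver_base
  -- notation
  set R := X.presheaf.stalk x with hR
  set A := Y.presheaf.stalk (f x) with hA
  set φ := (f.stalkMap x).hom with hφ
  -- `x` is a singular point: `x ∈ Ē ⊆ Sing(X)` (the singular locus is closed)
  have hSc := hS.isClosed_setOf_not_isRegularLocalRing
  have hreg : ¬ IsRegularLocalRing R := by
    have hsub : closure (Subtype.val '' E) ⊆
        ({x : X | ¬ IsRegularLocalRing (X.presheaf.stalk x)} : Set X) :=
      closure_minimal (by rintro _ ⟨z, -, rfl⟩; exact z.2) hSc
    exact hsub hxE
  have hns : ∀ U : X.Opens, x ∈ U → ¬ Smooth (U.ι ≫ f) :=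
    hS.not_smooth_of_not_isRegularLocalRing hreg
  have hxD : f x ∈ D := hS.apply_mem_of_not_isRegularLocalRing hreg
  have hy : IsClosed ({f x} : Set Y) := by
    rw [← Set.image_singleton]
    exact f.isClosedMap _ hx
  -- the base parameters adapted to `D`
  obtain ⟨ρ, e₀, t, s, hdimA, hspanA, hIA, hρ⟩ := hS.exists_rsop_stalkIdeal_base (f x)
  have hρ1 : 1 ≤ ρ := hρ hxD
  set m := ρ + e₀ with hm
  set w : Fin m → A := Fin.append t s with hw
  have hspanW : Ideal.span (Set.range w) = maximalIdeal A := by rw [hw, range_fin_append, hspanA]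
  have hIW : stalkIdeal (vanishingIdeal ⟨D, hS.isStrictNormalCrossingsDivisor.isClosed⟩) (f x) =
      Ideal.span {∏ i ∈ Finset.univ.filter (fun i : Fin m => i.val < ρ), w i} := by
    rw [hIA, hw, Fin.prod_filter_lt_append]
  -- the split nodal structure and `νᵢ ≤ 1`
  obtain ⟨ν, e, hν, he⟩ := hN k X Y f g D n τ hS x hx hns m ρ w hspanW hdimA
    (Nat.le_add_right ρ e₀) hIW
  have hν1 : ∀ i, ν i ≤ 1 :=
    (DeJong1996CodimThreeExponentsLeOne.of_polynomial hp) k X Y f g D n τ hS hcodim m ν x hx ⟨e⟩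
  -- `R` is a G-ring; `P = I_{E,x}` is a minimal non-regular prime of `R`
  have hG : IsGRing R := isGRing_stalk_of_polynomial hp (f ≫ g) x
  obtain ⟨hPp, hPreg, hPmin⟩ := stalkIdeal_vanishingIdeal_component hSc hE hxE
  set P := stalkIdeal (DeJong1996.singularComponentIdeal E) x with hP
  haveI : P.IsPrime := hPp
  -- Steps 1–2: `P R̂ = e⁻¹(u, v, T_a, T_b)`
  obtain ⟨a, b, hab, ha, hb, hta, htb, hPJ⟩ :=
    core_map_eq hG hν1 e (fun i => φ (w i)) he P hPreg hPmin
  have ha0 : ν a ≠ 0 := by rw [ha]; exact one_ne_zero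
  have hb0 : ν b ≠ 0 := by rw [hb]; exact one_ne_zero
  -- `a, b < ρ` (the exponents vanish beyond `ρ`)
  have haρ : a.val < ρ := by
    by_contra h
    exact ha0 (hν a (not_lt.mp h))
  have hbρ : b.val < ρ := by
    by_contra h
    exact hb0 (hν b (not_lt.mp h))
  set a' : Fin ρ := ⟨a.val, haρ⟩ with ha'
  set b' : Fin ρ := ⟨b.val, hbρ⟩ with hb'
  have hwa : w a = t a' := by
    have : a = Fin.castAdd e₀ a' := Fin.ext rfl
    rw [this, hw, Fin.append_left]
  have hwb : w b = t b' := by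
    have : b = Fin.castAdd e₀ b' := Fin.ext rfl
    rw [this, hw, Fin.append_left]
  have ha'b' : a' ≠ b' := fun h => hab (Fin.ext (by
    have := congrArg Fin.val h
    simpa [ha', hb'] using this))
  -- Step 3: `Â/(t_a, t_b) ≅ R̂/P R̂`
  haveI := hS.isRegular_base (f x)
  have hres : ∀ r : R, ∃ c : A, φ c - r ∈ maximalIdeal R :=
    exists_stalkMap_sub_mem_maximalIdeal f g hx hy
  obtain ⟨θ, hθ, hsurj, hker⟩ := core_bijective e φ w hspanW hdimA he hres P hab ha0 hb0 hta htb hPJ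
  rw [hwa, hwb] at hker
  -- the isomorphism and its compatibility
  let θ' := RingHom.quotientKerEquivOfSurjective hsurj
  let ι₁ : DeJong1996.CompletedBranchRing A (t a') (t b') ≃+*
      (AdicCompletion (maximalIdeal A) A ⧸ RingHom.ker θ) :=
    Ideal.quotEquivOfEq hker.symm
  let ι₂ : DeJong1996.CompletedQuotient R P ≃+*
      (AdicCompletion (maximalIdeal R) R ⧸ P.map (algebraMap R (AdicCompletion (maximalIdeal R) R))) :=
    (quotientCompletionEquiv (maximalIdeal R) P).symm
  refine ⟨ρ, e₀, t, s, hρ1, hdimA, hspanA, ?_, a', b', ha'b', ι₂.trans (ι₁.trans θ').symm, ?_⟩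
  · -- the ideal of `D` on affine opens
    intro U hU
    have hcl : (⟨closure D, isClosed_closure⟩ : Closeds Y) =
        ⟨D, hS.isStrictNormalCrossingsDivisor.isClosed⟩ :=
      Closeds.ext hS.isStrictNormalCrossingsDivisor.isClosed.closure_eq
    rw [hcl, ← stalkIdeal_eq_map_germ _ U hU, hIA]
  · intro c
    have h1 : (ι₁.trans θ') (DeJong1996.CompletedBranchRing.mk A (t a') (t b') c) =
        Ideal.Quotient.mk _ (algebraMap R (AdicCompletion (maximalIdeal R) R) (φ c)) := by
      rw [← hθ c]
      rfl
    have h2 : ι₂ (DeJong1996.CompletedQuotient.mk R P (φ c)) =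
        Ideal.Quotient.mk _ (algebraMap R (AdicCompletion (maximalIdeal R) R) (φ c)) := by
      rw [RingEquiv.symm_apply_eq, DeJong1996.CompletedQuotient.mk_apply,
        AdicCompletion.algebraMap_apply (maximalIdeal R) (φ c), Algebra.algebraMap_self,
        RingHom.id_apply, quotientCompletionEquiv_mk_of,
        AdicCompletion.algebraMap_apply ((maximalIdeal R).map (Ideal.Quotient.mk P))
          (Ideal.Quotient.mk P (φ c)), Algebra.algebraMap_self, RingHom.id_apply]
    rw [RingEquiv.trans_apply, RingEquiv.symm_apply_eq, h1, h2]

/-- **B5 — the components of `Sing(X)` are regular — from the same two leaves**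
(`DeJong1996CodimThreeSingularComponentsRegular.of_formal`). [cite: DeJong1996, 3.5, p. 64] -/
theorem DeJong1996CodimThreeSingularComponentsRegular.of_splitNodal_of_polynomial
    (hN : DeJong1996SplitNodalStructure.{u}) (hp : Matsumura1987_32_polynomial.{u}) :
    DeJong1996CodimThreeSingularComponentsRegular.{u} :=
  DeJong1996CodimThreeSingularComponentsRegular.of_formal
    (DeJong1996CodimThreeSingularComponentsFormal.of_splitNodal_of_polynomial hN hp)

/-- **4.24, second sentence (`DeJong1996SemiStablePairIsNormalForm`) from B1 (proved), B2, B3 and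
the two leaves.** [cite: DeJong1996, 3.5 and 4.24, pp. 64, 75] -/
theorem DeJong1996SemiStablePairIsNormalForm.of_parts_of_splitNodal_of_polynomial
    (h₂ : DeJong1996SemiStableBoundaryNormalCrossings.{u}) (h₃ : DeJong1996CodimThreeNodalForm.{u})
    (hN : DeJong1996SplitNodalStructure.{u}) (hp : Matsumura1987_32_polynomial.{u}) :
    DeJong1996SemiStablePairIsNormalForm.{u} :=
  DeJong1996SemiStablePairIsNormalForm.of_parts DeJong1996SemiStableBoundaryIsDivisor_holds h₂ h₃
    (DeJong1996CodimThreeSingularComponentsRegular.of_splitNodal_of_polynomial hN hp)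

end Literature.AlgebraicGeometry.Resolution

end
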